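import Literature.NumberTheory.EllipticCurves.HeegnerPointsHeckeOrbitOrders
import HarnessLib

/-!
# `Aut(ℂ/K[f])` is (simply) TRANSITIVE on the Hecke neighbours of a CM point of conductor `f` on `Y₀(N)`
# — Gross 1991 §3 / Nekovář 2007 Prop. (4.8) (ii) without `gcd(N, d_K) = 1` (second half)

Topic `NumberTheory/EllipticCurves` (complex multiplication; sequel of `HeegnerPointsHeckeOrbitOrders`,
split off for size), namespace `Literature.NumberTheory.EllipticCurves`.  Theorems only: no definition,
no named fact (D-0026); unconditional.

Setting and hypotheses as in `HeegnerPointsHeckeOrbitOrders.lean`: `K` imaginary quadratic, `ι : K → ℂ`,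
`x ∈ ℍ` a point whose point of `Y₀(N)` is fixed by `Aut(ℂ/K[f])` in transport form (`hfix`; e.g.
`x = τ_Q` for a level-`N` Heegner form `Q` of discriminant `f² d_K` with Bezout data,
`levelTransport_self_of_fix_ringClassField_bezout`), `ℓ` a prime inert in `K` with `ℓ ∤ N`, `ℓ ∤ f`,
`f ≥ 1`, `f ≥ 2` or `d_K < −4` (Nekovář's `u(r) = 1`), and `τ_{Q'}` a Hecke `ℓ`-neighbour of `x` with
`Q'` primitive positive definite of discriminant `(ℓf)² d_K` (e.g. `x/ℓ`, `HeegnerFormsConductorMul`).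
From the COUNT of the parent file (`card_kleinJ_heckeNeighbours_of_fix`: the `j`-values of `T_ℓ(x)`
are `ℓ + 1` in number and form the `Aut(ℂ/K[f])`-orbit of `j(τ_{Q'})`):

* `injOn_kleinJ_tpB_of_fix`, `kleinJ_tpD_not_mem_image_kleinJ_tpB_of_fix` — the `ℓ + 1` points of
  `T_ℓ(x)` have pairwise distinct `j`-invariants;
* `exists_gamma0_smul_eq_of_kleinJ_eq_of_fix` — two Hecke neighbours with the same `j` are
  `Γ₀(N)`-equivalent;
* **`exists_ringEquiv_levelTransport_of_isHeckeNeighbour_of_fix`** — EVERY Hecke `ℓ`-neighbour of `x`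
  is the `LevelTransport`-image of `τ_{Q'}` under some `σ ∈ Aut(ℂ/K[f])` (Gross 1991, proof of
  Prop. 3.7: *"the points in the divisor `T_ℓ(x_m)` are the conjugates of `x_n` over `K_m`"*; Nekovář
  2007 Prop. (4.8) (ii): the equality of divisors `T(ℓ)x(𝔫) = u(r) Σ_σ σ(x(𝔫ℓ))`), with the `j`-orbit
  form `exists_ringEquiv_apply_kleinJ_eq_of_isHeckeNeighbour_of_fix`;
* `eqOn_ringClassField_of_levelTransport_of_gamma0_smul_eq_of_formJ` — uniqueness on `K[ℓf]` (Darmon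
  2004, proof of Prop. 3.10: *"a simply transitive action of `Gal(H_{nℓ}/H_n)`"*).

Twins of `injOn_kleinJ_tpB_heegnerPointOfConductor`, `kleinJ_tpD_not_mem_image_kleinJ_tpB`,
`exists_gamma0_smul_eq_of_kleinJ_eq`, `exists_ringEquiv_levelTransport_of_isHeckeNeighbour`,
`exists_ringEquiv_apply_kleinJ_eq_of_isHeckeNeighbour`,
`eqOn_ringClassField_of_levelTransport_of_gamma0_smul_eq` (`HeegnerPointsHeckeOrbit.lean`), whose proofs
are followed step for step.

## References
* B. H. Gross, *Kolyvagin's work on modular elliptic curves*, LMS LNS 153 (1991), §3, proof of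
  Prop. 3.7 (PDF p. 217 L24–26, p. 218 L5–6 of `book:editornd-l-functions-arithmetic`). [GrossLMS1991]
* J. Nekovář, *The Euler system method for CM points on Shimura curves*, LMS LNS 320 (2007),
  Prop. (4.8) (ii) (PDF p. 0570 L11–15 of `book:burns2007-l-functions-galois-representations`:
  "We have an equality of divisors … `T(ℓ) x(𝔫) = u(r) Σ_σ σ(x(𝔫ℓ))`"). [Nekovar2007]
* H. Darmon, *Rational points on modular elliptic curves*, CBMS 101 (2004), Prop. 3.10. [Darmon2004]

## Mathlib / tree search
Tree: `exists_image_kleinJ_eq_kleinJ_heckeNeighbours_of_fix`, `card_kleinJ_heckeNeighbours_of_fix`,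
`exists_isHeckeNeighbour_levelTransport_of_fix'`, `eqOn_ringClassField_of_apply_formJ_eq`
(`HeegnerPointsHeckeOrbitOrders`); `exists_gamma0_smul_eq_of_isHeckeNeighbour`,
`kleinJ_mem_of_isHeckeNeighbour`, `LevelTransport.kleinJ_eq`, `LevelTransport.of_gamma0_smul_eq_right`
(`HeckeNeighbourTransport`, `LevelStructureTransport`); `kleinJ_smul`, `formJ_eq_kleinJ`.
`lean search 'of_kleinJ_eq_of_fix|isHeckeNeighbour_of_fix'` → nothing before this pair of files.
presearch: [corpus:book:editornd-l-functions-arithmetic p0217:L24–26, p0218:L5–6];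
[corpus:book:burns2007-l-functions-galois-representations p0570:L11–15]; port of tree proofs.
-/

noncomputable section

open Complex UpperHalfPlane CongruenceSubgroup PeriodPair NumberField
open scoped MatrixGroups IntermediateField

namespace Literature.NumberTheory.EllipticCurves

open Literature.NumberTheory.EllipticCurves.ModularForms
  Literature.NumberTheory.QuadraticFields.BinaryQuadraticForm
  Literature.NumberTheory.QuadraticFields.Quadratic

variable {K : Type} [Field K] [NumberField K]

section Orbit

variable {N : ℕ} [NeZero N]

/-! ### Distinct `j`-invariants and `Γ₀(N)`-equivalence on `T_ℓ(x)` -/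

/-- **The `ℓ` points `(x + j)/ℓ`, `0 ≤ j < ℓ`, of `T_ℓ(x)` have pairwise distinct `j`-invariants.**
[cite: GrossLMS1991, §3 (proof of Prop. 3.7: T_ℓ(x_m) of degree ℓ + 1)] -/
theorem injOn_kleinJ_tpB_of_fix (hK : IsImaginaryQuadratic K)
    (ι : K →+* ℂ) {f ℓ : ℕ} (hℓ : ℓ.Prime) (hinert : (Ideal.span {(ℓ : 𝓞 K)}).IsPrime)
    (hℓN : ¬ ℓ ∣ N) (hℓf : ¬ ℓ ∣ f) (hf : f ≠ 0) (hunits : 2 ≤ f ∨ NumberField.discr K < -4)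
    [NeZero ℓ] {x : ℍ}
    (hfix : ∀ σ : ℂ ≃+* ℂ, (∀ z ∈ ringClassField K ι f, σ z = z) → LevelTransport N σ x x)
    {Q' : ℤ × ℤ × ℤ} (hQ'1 : 0 < Q'.1) (hQ'prim : IsPrimitive Q')
    (hQ'disc : discr Q' = ((ℓ * f : ℕ) : ℤ) ^ 2 * NumberField.discr K)
    (hx' : IsHeckeNeighbour N ℓ x (heegnerTau Q')) :
    Set.InjOn (fun j : ℕ => kleinJ (tpB ℓ (j : ℤ) • x)) (Finset.range ℓ : Set ℕ) := by
  classical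
  have hcard := card_kleinJ_heckeNeighbours_of_fix hK ι hℓ hinert hℓN hℓf hf hunits hfix hQ'1 hQ'prim
    hQ'disc hx'
  rw [← Finset.card_image_iff]
  apply le_antisymm Finset.card_image_le
  have h := Finset.card_union_le ((Finset.range ℓ).image (fun j : ℕ => kleinJ (tpB ℓ (j : ℤ) • x)))
    {kleinJ (tpD ℓ • x)}
  rw [hcard, Finset.card_singleton] at h
  rw [Finset.card_range]
  have h' := Finset.card_image_le (s := Finset.range ℓ) (f := fun j : ℕ => kleinJ (tpB ℓ (j : ℤ) • x))
  rw [Finset.card_range] at h'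
  omega

/-- **`j(ℓ x)` differs from every `j((x + j)/ℓ)`**, `0 ≤ j < ℓ` (same hypotheses).
[cite: GrossLMS1991, §3 (proof of Prop. 3.7: T_ℓ(x_m) of degree ℓ + 1)] -/
theorem kleinJ_tpD_not_mem_image_kleinJ_tpB_of_fix (hK : IsImaginaryQuadratic K)
    (ι : K →+* ℂ) {f ℓ : ℕ} (hℓ : ℓ.Prime) (hinert : (Ideal.span {(ℓ : 𝓞 K)}).IsPrime)
    (hℓN : ¬ ℓ ∣ N) (hℓf : ¬ ℓ ∣ f) (hf : f ≠ 0) (hunits : 2 ≤ f ∨ NumberField.discr K < -4)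
    [NeZero ℓ] {x : ℍ}
    (hfix : ∀ σ : ℂ ≃+* ℂ, (∀ z ∈ ringClassField K ι f, σ z = z) → LevelTransport N σ x x)
    {Q' : ℤ × ℤ × ℤ} (hQ'1 : 0 < Q'.1) (hQ'prim : IsPrimitive Q')
    (hQ'disc : discr Q' = ((ℓ * f : ℕ) : ℤ) ^ 2 * NumberField.discr K)
    (hx' : IsHeckeNeighbour N ℓ x (heegnerTau Q')) :
    kleinJ (tpD ℓ • x) ∉ (Finset.range ℓ).image (fun j : ℕ => kleinJ (tpB ℓ (j : ℤ) • x)) := by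
  classical
  intro hmem
  have hcard := card_kleinJ_heckeNeighbours_of_fix hK ι hℓ hinert hℓN hℓf hf hunits hfix hQ'1 hQ'prim
    hQ'disc hx'
  rw [Finset.union_eq_left.mpr (Finset.singleton_subset_iff.mpr hmem)] at hcard
  have h := Finset.card_image_le (s := Finset.range ℓ) (f := fun j : ℕ => kleinJ (tpB ℓ (j : ℤ) • x))
  rw [hcard, Finset.card_range] at h
  omega

omit [NeZero N] in
/-- From `γ₁ • τ₁ = r = γ₂ • τ₂` (`γ_i ∈ Γ₀(N)`) to `Γ₀(N)`-equivalence of `τ₁`, `τ₂`. Private helper.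
[folklore] -/
private theorem exists_gamma0_smul_eq_of_smul_eq' {τ₁ τ₂ r : ℍ} {γ₁ γ₂ : Gamma0 N}
    (e₁ : (γ₁ : SL(2, ℤ)) • τ₁ = r) (e₂ : (γ₂ : SL(2, ℤ)) • τ₂ = r) :
    ∃ γ : Gamma0 N, (γ : SL(2, ℤ)) • τ₁ = τ₂ := by
  refine ⟨γ₂⁻¹ * γ₁, ?_⟩
  rw [Subgroup.coe_mul, Subgroup.coe_inv, mul_smul, e₁, ← e₂, inv_smul_smul]

/-- **Two Hecke `ℓ`-neighbours of `x` with the same `j`-invariant are `Γ₀(N)`-equivalent** — `j` is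
injective on the `ℓ + 1` points of the divisor `T_ℓ(x)` of `Y₀(N)` (same hypotheses).
[cite: GrossLMS1991, §3 (proof of Prop. 3.7: T_ℓ(x_m) of degree ℓ + 1)] -/
theorem exists_gamma0_smul_eq_of_kleinJ_eq_of_fix (hK : IsImaginaryQuadratic K)
    (ι : K →+* ℂ) {f ℓ : ℕ} (hℓ : ℓ.Prime) (hinert : (Ideal.span {(ℓ : 𝓞 K)}).IsPrime)
    (hℓN : ¬ ℓ ∣ N) (hℓf : ¬ ℓ ∣ f) (hf : f ≠ 0) (hunits : 2 ≤ f ∨ NumberField.discr K < -4)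
    {x : ℍ} (hfix : ∀ σ : ℂ ≃+* ℂ, (∀ z ∈ ringClassField K ι f, σ z = z) → LevelTransport N σ x x)
    {Q' : ℤ × ℤ × ℤ} (hQ'1 : 0 < Q'.1) (hQ'prim : IsPrimitive Q')
    (hQ'disc : discr Q' = ((ℓ * f : ℕ) : ℤ) ^ 2 * NumberField.discr K)
    (hx' : IsHeckeNeighbour N ℓ x (heegnerTau Q')) {τ₁ τ₂ : ℍ}
    (h₁ : IsHeckeNeighbour N ℓ x τ₁) (h₂ : IsHeckeNeighbour N ℓ x τ₂) (hj : kleinJ τ₁ = kleinJ τ₂) :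
    ∃ γ : Gamma0 N, (γ : SL(2, ℤ)) • τ₁ = τ₂ := by
  classical
  haveI : NeZero ℓ := ⟨hℓ.ne_zero⟩
  have hinj := injOn_kleinJ_tpB_of_fix hK ι hℓ hinert hℓN hℓf hf hunits hfix hQ'1 hQ'prim hQ'disc hx'
  have hnot := kleinJ_tpD_not_mem_image_kleinJ_tpB_of_fix hK ι hℓ hinert hℓN hℓf hf hunits hfix hQ'1
    hQ'prim hQ'disc hx'
  have hmemB : ∀ {j : ℤ}, 0 ≤ j → j < ℓ →
      kleinJ (tpB ℓ j • x) ∈ (Finset.range ℓ).image (fun j : ℕ => kleinJ (tpB ℓ (j : ℤ) • x)) := by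
    intro j hj0 hjℓ
    refine Finset.mem_image.mpr ⟨j.toNat, Finset.mem_range.mpr (by omega), ?_⟩
    simp only [Int.toNat_of_nonneg hj0]
  rcases exists_gamma0_smul_eq_of_isHeckeNeighbour hℓ hℓN h₁ with ⟨j₁, hj₁0, hj₁ℓ, γ₁, e₁⟩ | ⟨γ₁, e₁⟩
  · rcases exists_gamma0_smul_eq_of_isHeckeNeighbour hℓ hℓN h₂ with ⟨j₂, hj₂0, hj₂ℓ, γ₂, e₂⟩ | ⟨γ₂, e₂⟩
    · -- both of type `(x + j)/ℓ`: `j₁ = j₂` by injectivity of `j`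
      have hjj : kleinJ (tpB ℓ j₁ • x) = kleinJ (tpB ℓ j₂ • x) := by
        rw [← e₁, ← e₂, kleinJ_smul, kleinJ_smul, hj]
      have hnat : j₁.toNat = j₂.toNat := by
        refine hinj (Finset.mem_coe.mpr (Finset.mem_range.mpr (by omega)))
          (Finset.mem_coe.mpr (Finset.mem_range.mpr (by omega))) ?_
        simp only [Int.toNat_of_nonneg hj₁0, Int.toNat_of_nonneg hj₂0]
        exact hjj
      have hjeq : j₁ = j₂ := by
        rw [← Int.toNat_of_nonneg hj₁0, ← Int.toNat_of_nonneg hj₂0, hnat]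
      subst hjeq
      exact exists_gamma0_smul_eq_of_smul_eq' e₁ e₂
    · exfalso
      apply hnot
      rw [← e₂, kleinJ_smul, ← hj, ← kleinJ_smul (γ₁ : SL(2, ℤ)) τ₁, e₁]
      exact hmemB hj₁0 hj₁ℓ
  · rcases exists_gamma0_smul_eq_of_isHeckeNeighbour hℓ hℓN h₂ with ⟨j₂, hj₂0, hj₂ℓ, γ₂, e₂⟩ | ⟨γ₂, e₂⟩
    · exfalso
      apply hnot
      rw [← e₁, kleinJ_smul, hj, ← kleinJ_smul (γ₂ : SL(2, ℤ)) τ₂, e₂]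
      exact hmemB hj₂0 hj₂ℓ
    · exact exists_gamma0_smul_eq_of_smul_eq' e₁ e₂

/-! ### Transitivity and its uniqueness half -/

/-- **Transitivity of `Aut(ℂ/K[f])` on `T_ℓ(x)` for a CM point `x` of conductor `f` — Gross 1991 §3 /
Nekovář 2007 (4.8) without `gcd(N, d_K) = 1`.**  Let `K` be imaginary quadratic, `ι : K → ℂ`,
`x ∈ ℍ` a point whose point of `Y₀(N)` is fixed by `Aut(ℂ/K[f])` (`hfix`; e.g. `x = τ_Q` for a
level-`N` Heegner form `Q` of discriminant `f² d_K` with Bezout data,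
`levelTransport_self_of_fix_ringClassField_bezout`), `ℓ` a prime inert in `K` with `ℓ ∤ N`, `ℓ ∤ f`,
`f ≥ 1`, `f ≥ 2` or `d_K < −4`, and `τ_{Q'}` a Hecke `ℓ`-neighbour of `x` with `Q'` primitive positive
definite of discriminant `(ℓf)² d_K` (e.g. `x/ℓ`).  Then for every Hecke `ℓ`-neighbour `τ₁` of `x`
there is an automorphism `σ` of `ℂ` fixing `K[f]` pointwise with `LevelTransport N σ τ_{Q'} τ₁`
(`(E_{τ_{Q'}}, C)^σ ≅ (E_{τ₁}, C₁)`).  Proof by counting, as in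
`exists_ringEquiv_levelTransport_of_isHeckeNeighbour`.
[cite: GrossLMS1991, §3 (proof of Prop. 3.7, PDF p. 217 L24–26, p. 218 L5–6)]
[cite: Nekovar2007, Prop. (4.8) (ii) (p. 0570)] [cite: Darmon2004, Prop. 3.10 (proof, pp. 35–36)] -/
theorem exists_ringEquiv_levelTransport_of_isHeckeNeighbour_of_fix (hK : IsImaginaryQuadratic K)
    (ι : K →+* ℂ) {f ℓ : ℕ} (hℓ : ℓ.Prime) (hinert : (Ideal.span {(ℓ : 𝓞 K)}).IsPrime)
    (hℓN : ¬ ℓ ∣ N) (hℓf : ¬ ℓ ∣ f) (hf : f ≠ 0) (hunits : 2 ≤ f ∨ NumberField.discr K < -4)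
    {x : ℍ} (hfix : ∀ σ : ℂ ≃+* ℂ, (∀ z ∈ ringClassField K ι f, σ z = z) → LevelTransport N σ x x)
    {Q' : ℤ × ℤ × ℤ} (hQ'1 : 0 < Q'.1) (hQ'prim : IsPrimitive Q')
    (hQ'disc : discr Q' = ((ℓ * f : ℕ) : ℤ) ^ 2 * NumberField.discr K)
    (hx' : IsHeckeNeighbour N ℓ x (heegnerTau Q')) {τ₁ : ℍ} (h₁ : IsHeckeNeighbour N ℓ x τ₁) :
    ∃ σ : ℂ ≃+* ℂ, (∀ z ∈ ringClassField K ι f, σ z = z) ∧ LevelTransport N σ (heegnerTau Q') τ₁ := by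
  classical
  haveI : NeZero ℓ := ⟨hℓ.ne_zero⟩
  obtain ⟨σ, hσfix, -, himage⟩ := exists_image_kleinJ_eq_kleinJ_heckeNeighbours_of_fix hK ι hℓ hinert
    hℓN hℓf hf hunits hfix hQ'1 hQ'prim hQ'disc hx'
  -- `j(τ₁) = σ_i (j(τ_{Q'}))` for some `i`
  have hmem := kleinJ_mem_of_isHeckeNeighbour hℓ hℓN h₁
  rw [← himage, Finset.mem_image] at hmem
  obtain ⟨i, -, hi⟩ := hmem
  -- `σ_i` carries `τ_{Q'}` to a neighbour `τ₁'` with the same `j` as `τ₁`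
  obtain ⟨τ₁', h₁', hT⟩ := exists_isHeckeNeighbour_levelTransport_of_fix' ι hℓ hℓN hfix hx' (hσfix i)
  have hj : kleinJ τ₁' = kleinJ τ₁ := by rw [hT.kleinJ_eq, hi]
  obtain ⟨γ, hγ⟩ := exists_gamma0_smul_eq_of_kleinJ_eq_of_fix hK ι hℓ hinert hℓN hℓf hf hunits hfix hQ'1
    hQ'prim hQ'disc hx' h₁' h₁ hj
  exact ⟨σ i, hσfix i, hT.of_gamma0_smul_eq_right hγ⟩

/-- **The `j`-orbit form**: for every Hecke `ℓ`-neighbour `τ₁` of `x` there is `σ ∈ Aut(ℂ/K[f])` with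
`σ(j(τ_{Q'})) = j(τ₁)` — the `j`-invariants of the points of `T_ℓ(x)` are exactly the conjugates of
`j(τ_{Q'})` over `K[f]`. [cite: GrossLMS1991, §3 (proof of Prop. 3.7, PDF p. 218 L5–6)] -/
theorem exists_ringEquiv_apply_kleinJ_eq_of_isHeckeNeighbour_of_fix (hK : IsImaginaryQuadratic K)
    (ι : K →+* ℂ) {f ℓ : ℕ} (hℓ : ℓ.Prime) (hinert : (Ideal.span {(ℓ : 𝓞 K)}).IsPrime)
    (hℓN : ¬ ℓ ∣ N) (hℓf : ¬ ℓ ∣ f) (hf : f ≠ 0) (hunits : 2 ≤ f ∨ NumberField.discr K < -4)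
    {x : ℍ} (hfix : ∀ σ : ℂ ≃+* ℂ, (∀ z ∈ ringClassField K ι f, σ z = z) → LevelTransport N σ x x)
    {Q' : ℤ × ℤ × ℤ} (hQ'1 : 0 < Q'.1) (hQ'prim : IsPrimitive Q')
    (hQ'disc : discr Q' = ((ℓ * f : ℕ) : ℤ) ^ 2 * NumberField.discr K)
    (hx' : IsHeckeNeighbour N ℓ x (heegnerTau Q')) {τ₁ : ℍ} (h₁ : IsHeckeNeighbour N ℓ x τ₁) :
    ∃ σ : ℂ ≃+* ℂ, (∀ z ∈ ringClassField K ι f, σ z = z) ∧ σ (kleinJ (heegnerTau Q')) = kleinJ τ₁ := by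
  obtain ⟨σ, hσ, hT⟩ := exists_ringEquiv_levelTransport_of_isHeckeNeighbour_of_fix hK ι hℓ hinert hℓN
    hℓf hf hunits hfix hQ'1 hQ'prim hQ'disc hx' h₁
  exact ⟨σ, hσ, hT.kleinJ_eq.symm⟩

/-- **Simple transitivity (uniqueness half)**: if `σ, σ' ∈ Aut(ℂ/ι(K))` transport the level-`N`
structure of `τ_{Q'}` (`Q'` primitive positive definite of discriminant `(ℓf)² d_K`) to
`Γ₀(N)`-equivalent points, then `σ` and `σ'` agree on `K[ℓf]` (both send the generator `j(τ_{Q'})` of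
`K[ℓf]/K` to the common `j`-invariant of the targets).  Darmon 2004: *"simply transitive action of
`Gal(H_{nℓ}/H_n)`"*, in `Aut(ℂ)`-currency. [cite: Darmon2004, Prop. 3.10 (proof, pp. 35–36)]
[cite: GrossLMS1991, §3 (proof of Prop. 3.7, PDF p. 218 L5–6)] -/
theorem eqOn_ringClassField_of_levelTransport_of_gamma0_smul_eq_of_formJ (hK : IsImaginaryQuadratic K)
    (ι : K →+* ℂ) {f ℓ : ℕ} (hℓ : ℓ.Prime) (hf : f ≠ 0) {Q' : ℤ × ℤ × ℤ} (hQ'1 : 0 < Q'.1)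
    (hQ'prim : IsPrimitive Q') (hQ'disc : discr Q' = ((ℓ * f : ℕ) : ℤ) ^ 2 * NumberField.discr K)
    {σ σ' : ℂ ≃+* ℂ} (hσ : ∀ k : K, σ (ι k) = ι k) (hσ' : ∀ k : K, σ' (ι k) = ι k) {τ₁ τ₁' : ℍ}
    (hT : LevelTransport N σ (heegnerTau Q') τ₁) (hT' : LevelTransport N σ' (heegnerTau Q') τ₁')
    {γ : Gamma0 N} (hγ : (γ : SL(2, ℤ)) • τ₁ = τ₁') :
    Set.EqOn σ σ' (ringClassField K ι (ℓ * f)) := by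
  have hj : σ (kleinJ (heegnerTau Q')) = σ' (kleinJ (heegnerTau Q')) := by
    rw [← hT.kleinJ_eq, ← hT'.kleinJ_eq, ← hγ, kleinJ_smul]
  rw [← formJ_eq_kleinJ] at hj
  exact eqOn_ringClassField_of_apply_formJ_eq hK ι (mul_ne_zero hℓ.ne_zero hf) hQ'1 hQ'prim hQ'disc
    (φ := σ.toRingHom) (ψ := σ'.toRingHom) (fun k => by simpa using (hσ k).trans (hσ' k).symm)
    (by simpa using hj)

end Orbit

end Literature.NumberTheory.EllipticCurves

end
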